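import Summits.Ventures.GridStability.Lyapunov.PolyRecast
import Mathlib.Tactic.LinearCombination
import HarnessLib

/-!
# GridStability/Lyapunov/PolyRecastLieChunks — the `V̇ = lieDeriv F V` link in FIELD-COMPONENT CHUNKS

Cell `gridfusion` (LADDER-GRIDFUSION), `plan/PARTITION.md` §0 row `Lyapunov/` (generic glue, extending lyap-1's
`PolyRecast.lean` p482110; seat gridfusion-sos-3 (g3) for the deg-4 WSCC9 «…Roa» companions). PURPOSE: the
one-`decide` link `isZero (add Vdot (neg (lieDeriv F V)))` of `PolyRecast.hasDerivWithinAt_eval_of_isZero`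
computes the whole Lie derivative in ONE kernel evaluation; for the deg-4 WSCC9 certificates (V 253–324
monomials, 7 field components, V̇ 663–723 monomials) this does NOT reduce («Decidable instance … did not
reduce to isTrue/isFalse», 130 s, measured 2026-08-27T05:3xZ on `Bench/WSCC9Deg4ASosgramDinstData1`) — the
same single-`decide` wall lit-5 recorded for the Gram residuals (register D8: ≤ 80 s per `decide`). Here the
link is split per FIELD COMPONENT with kernel-checked PARTIAL SUMS (the L8 idea of `GramSOSList`):
`P₀ = []`, and for `k < N` one `decide` each: `isZero (add (add P_{k+1} (neg P_k)) (neg (norm (mul F_k (pderiv k V)))))`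
(`norm` re-trims the exponent vectors that `pderiv` leaves with trailing zeros, so that `isZero`'s exact-monomial
collection sees the same representation as the trimmed literals; `F_k` first keeps `mul`'s recursion shallow; the
nesting `add (add P' (neg P)) (neg T)` lets the linear MERGE do all cancellations when the `P` literals are written in
`Monomial.blt` order — measured 30 s kernel for the heaviest deg-4 WSCC9 link vs 105 s for `add P' (neg (P ++ T))`),
finally `isZero (add Vdot (neg P_N))` — every step evaluates ONE product `(∂_k V)·F_k` only. The partial
sums `P_k` are shipped as literal `Poly` data (any term order / normal form: only `eval` matters).

* `eval_lieDeriv_eq_sum_mul` — `eval (lieDeriv F V) = Σ_{k<numVars V} eval (mul (pderiv k V) F_k)`;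
* `eval_partialSum_of_links` — the links give `eval P_k = Σ_{j<k} eval (mul (pderiv j V) F_j)`;
* `eval_eq_lieDeriv_of_links` — with `numVars V = N` and the final link: `eval Vdot = eval (lieDeriv F V)`;
* `hasDerivWithinAt_eval_of_links` — the curve-form Lyapunov hypothesis (same shape as
  `PolyRecast.hasDerivWithinAt_eval_of_isZero`, with the chunked hypotheses in place of the one `decide`).

Pure bookkeeping: no definition, no named fact, standard axioms.
-/

noncomputable section

open Set Filter Topology Finset
open Literature.Computation.Certificates Literature.Computation.Certificates.SOS

namespace Summit.Ventures.GridStability.Lyapunov.PolyRecast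

/-- `eval` of the Lie derivative as a sum of `eval`s of the component PRODUCTS `(∂_k V)·F_k`.
[cite: RoucheHabetsLaloy1977, Ch. I §3.1 eq. (3.1)] -/
theorem eval_lieDeriv_eq_sum_mul {R : Type*} [Field R] [CharZero R] (x : ℕ → R) (F : List Poly) (V : Poly) :
    Poly.eval x (Poly.lieDeriv F V) =
      ∑ k ∈ range (Poly.numVars V), Poly.eval x (Poly.mul (Poly.pderiv k V) (F.getD k [])) := by
  rw [Poly.eval_lieDeriv]
  exact sum_congr rfl fun k _ => by rw [Poly.eval_mul]

/-- **Partial sums from links.** If `Ps.getD 0 [] = []` and for every `k < K` the `k`-th link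
`isZero (add P_{k+1} (neg (P_k ++ mul (pderiv k V) F_k)))` holds, then
`eval P_K = Σ_{j<K} eval (mul (pderiv j V) F_j)`. [folklore] -/
theorem eval_partialSum_of_links {R : Type*} [Field R] [CharZero R] (x : ℕ → R) (F Ps : List Poly) (V : Poly)
    (h0 : Ps.getD 0 [] = []) :
    ∀ K : ℕ, (∀ k < K, Poly.isZero (Poly.add (Poly.add (Ps.getD (k + 1) []) (Poly.neg (Ps.getD k [])))
        (Poly.neg (Poly.norm (Poly.mul (F.getD k []) (Poly.pderiv k V))))) = true) →
      Poly.eval x (Ps.getD K []) = ∑ j ∈ range K, Poly.eval x (Poly.mul (Poly.pderiv j V) (F.getD j []))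
  | 0, _ => by rw [h0]; simp
  | K + 1, h => by
      have ih := eval_partialSum_of_links x F Ps V h0 K fun k hk => h k (Nat.lt_succ_of_lt hk)
      have hK := eval_eq_of_isZero x (h K (Nat.lt_succ_self K))
      rw [Poly.eval_add, Poly.eval_neg, Poly.eval_norm, Poly.eval_mul] at hK
      have hK' : Poly.eval x (Ps.getD (K + 1) []) =
          Poly.eval x (Ps.getD K []) + Poly.eval x (F.getD K []) * Poly.eval x (Poly.pderiv K V) := by
        linear_combination hK
      rw [hK', ih, sum_range_succ, Poly.eval_mul, mul_comm (Poly.eval x (F.getD K []))]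

/-- **`eval Vdot = eval (lieDeriv F V)` from the chunked links** (`numVars V = N`, `N` links, one final
link `isZero (add Vdot (neg P_N))`). [folklore] -/
theorem eval_eq_lieDeriv_of_links {R : Type*} [Field R] [CharZero R] (x : ℕ → R) {F Ps : List Poly}
    {V Vdot : Poly} {N : ℕ} (hN : Poly.numVars V = N) (h0 : Ps.getD 0 [] = [])
    (hlinks : ∀ k < N, Poly.isZero (Poly.add (Poly.add (Ps.getD (k + 1) []) (Poly.neg (Ps.getD k [])))
        (Poly.neg (Poly.norm (Poly.mul (F.getD k []) (Poly.pderiv k V))))) = true)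
    (hfin : Poly.isZero (Poly.add Vdot (Poly.neg (Ps.getD N []))) = true) :
    Poly.eval x Vdot = Poly.eval x (Poly.lieDeriv F V) := by
  rw [eval_eq_of_isZero x hfin, eval_partialSum_of_links x F Ps V h0 N hlinks, eval_lieDeriv_eq_sum_mul, hN]

/-- **The curve-form Lyapunov hypothesis from CHUNKED links** (drop-in for
`hasDerivWithinAt_eval_of_isZero` when the one-`decide` link does not reduce): along every coordinatewise
solution `w` of the recast field `Fp` (as in `hasDerivWithinAt_eval_lieDeriv_fin`),
`τ ↦ V.eval (…(w τ))` has derivative `Vdot.eval (…(w t))` within `s` at `t`.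
[cite: RoucheHabetsLaloy1977, Ch. I §3.1 eq. (3.1)] -/
theorem hasDerivWithinAt_eval_of_links {N M : ℕ} {Fp Ps : List Poly} (hFN : Fp.length ≤ N)
    {V Vdot : Poly} (hM : Poly.numVars V = M) (h0 : Ps.getD 0 [] = [])
    (hlinks : ∀ k < M, Poly.isZero (Poly.add (Poly.add (Ps.getD (k + 1) []) (Poly.neg (Ps.getD k [])))
        (Poly.neg (Poly.norm (Poly.mul (Fp.getD k []) (Poly.pderiv k V))))) = true)
    (hfin : Poly.isZero (Poly.add Vdot (Poly.neg (Ps.getD M []))) = true)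
    {w : ℝ → Fin N → ℝ} {s : Set ℝ} {t : ℝ}
    (hw : ∀ i : Fin N, HasDerivWithinAt (fun τ => w τ i)
      (Poly.eval (vars (List.ofFn (w t))) (Fp.getD i [])) s t) :
    HasDerivWithinAt (fun τ => Poly.eval (vars (List.ofFn (w τ))) V)
      (Poly.eval (vars (List.ofFn (w t))) Vdot) s t := by
  rw [eval_eq_lieDeriv_of_links (vars (List.ofFn (w t))) hM h0 hlinks hfin]
  exact hasDerivWithinAt_eval_lieDeriv_fin hFN V hw

end Summit.Ventures.GridStability.Lyapunov.PolyRecast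

end
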